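import HarnessLib
import Summits.Ventures.WeilGRH.UniformConductorFloorPrincipal
import Summits.Ventures.WeilGRH.OneCompleteMod12
import Summits.Ventures.WeilGRH.OneCompleteMod16
import Summits.Ventures.WeilGRH.OneCompleteMod20
import Summits.Ventures.WeilGRH.OneCompleteMod21
import Summits.Ventures.WeilGRH.OneCompleteMod22
import Summits.Ventures.WeilGRH.OneCompleteMod26
import Summits.Ventures.WeilGRH.OneCompleteMod27
import Summits.Ventures.WeilGRH.OneCompleteMod28
import Summits.Ventures.WeilGRH.OneCompleteMod31
import Summits.Ventures.WeilGRH.OneCompleteMod33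
import Summits.Ventures.WeilGRH.OneCompleteMod35
import Summits.Ventures.WeilGRH.OneCompleteMod37
import Summits.Ventures.WeilGRH.OneCompleteMod39
import Summits.Ventures.WeilGRH.OneCompleteMod41
import Summits.Ventures.WeilGRH.OneCompleteMod43
import Summits.Ventures.WeilGRH.OneCompleteMod47
import Summits.Ventures.WeilGRH.OneCompleteMod49
import Summits.Ventures.WeilGRH.OneCompleteMod53
import Summits.Ventures.WeilGRH.OneCompleteMod55
import Summits.Ventures.WeilGRH.OneCompleteMod59
import Summits.Ventures.WeilGRH.OneCompleteMod61
import Summits.Ventures.WeilGRH.OneCompleteMod67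
import Summits.Ventures.WeilGRH.OneCompleteMod71
import Summits.Ventures.WeilGRH.OneCompleteMod73

/-!
# GRH arm (rh-explicit, venture WeilGRH): at `t = 1`, for 24 levels `q` between 12 and 73, EXACTLY the principal character fails

Cell `rh-explicit`, WEIL TRACK — GRH ARM (engine seat weil-grh-2 gen16; level 16 added and filed by weil-grh-1 gen12).  Single-sentence summary of the arm's per-level census at the window
`[−1, 1]`: for every modulus `q ∈ S = {12, 16, 20, 21, 22, 26, 27, 28, 31, 33, 35, 37, 39, 41, 43, 47, 49, 53, 55, 59, 61, 67, 71, 73}` and every Dirichlet character `χ` mod `q`,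
`WeilPositivityOnChar χ 1 ↔ χ ≠ 1`.  The «←» direction is the per-modulus assembly `OneCompleteMod<q>` (door-C χ-cells for the even complex
classes — primitive and, for composite `q`, the LIFTED classes of the divisor conductors —, the real islands, and the odd floors); the «→» direction is
weil-grh-1's flat-window refutation of the principal character (`UniformFloor.not_weilPositivityOnChar_one_principal`, `q ∈ F`).
Context: `UniformFloor.forall_weilPositivityOnChar_one_iff…` (weil-grh-1) decides «EVERY character mod q is positive» (`↔ q ∉ F`); the present file
refines it on `S ⊆ F`: there the failing set is exactly `{1}`.  The levels of `F` not in `S` are `2 … 11, 13, 14, 15, 17, 18, 19, 23, 25, 29` — the small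
conductors (even complex classes compiled for the checker-K door, odd classes in weil-grh-3's format-D-K lane).  Pure assembly; RH/GRH-free; standard axioms.
-/

noncomputable section

namespace Summit.Ventures.WeilGRH.OneCompleteLevels
open Literature.NumberTheory.LFunctions

/-- ★★★ **At `t = 1`, for every level `q ∈ {12, 16, 20, 21, 22, 26, 27, 28, 31, 33, 35, 37, 39, 41, 43, 47, 49, 53, 55, 59, 61, 67, 71, 73}` and every Dirichlet character `χ` mod `q`:
`WeilPositivityOnChar χ 1 ↔ χ ≠ 1`** — exactly the principal character fails Weil positivity on `[−1, 1]`.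
[cite: Weil1952FormulesExplicites, (11) pp. 261–262 and the «lemme» p. 262] -/
theorem weilPositivityOnChar_one_iff_ne_one {q : ℕ}
    (hq : q ∈ ({12, 16, 20, 21, 22, 26, 27, 28, 31, 33, 35, 37, 39, 41, 43, 47, 49, 53, 55, 59, 61, 67, 71, 73} : Finset ℕ)) (χ : DirichletCharacter ℂ q) :
    WeilPositivityOnChar χ 1 ↔ χ ≠ 1 := by
  have key12 : ∀ χ : DirichletCharacter ℂ 12, WeilPositivityOnChar χ 1 ↔ χ ≠ 1 := fun χ ↦
    ⟨fun h h1 ↦ UniformFloor.not_weilPositivityOnChar_one_principal (q := 12) (by decide) (h1 ▸ h), OneCompleteMod12.weilPositivityOnChar_mod12_one χ⟩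
  have key16 : ∀ χ : DirichletCharacter ℂ 16, WeilPositivityOnChar χ 1 ↔ χ ≠ 1 := fun χ ↦
    ⟨fun h h1 ↦ UniformFloor.not_weilPositivityOnChar_one_principal (q := 16) (by decide) (h1 ▸ h), OneCompleteMod16.weilPositivityOnChar_mod16_one χ⟩
  have key20 : ∀ χ : DirichletCharacter ℂ 20, WeilPositivityOnChar χ 1 ↔ χ ≠ 1 := fun χ ↦
    ⟨fun h h1 ↦ UniformFloor.not_weilPositivityOnChar_one_principal (q := 20) (by decide) (h1 ▸ h), OneCompleteMod20.weilPositivityOnChar_mod20_one χ⟩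
  have key21 : ∀ χ : DirichletCharacter ℂ 21, WeilPositivityOnChar χ 1 ↔ χ ≠ 1 := fun χ ↦
    ⟨fun h h1 ↦ UniformFloor.not_weilPositivityOnChar_one_principal (q := 21) (by decide) (h1 ▸ h), OneCompleteMod21.weilPositivityOnChar_mod21_one χ⟩
  have key22 : ∀ χ : DirichletCharacter ℂ 22, WeilPositivityOnChar χ 1 ↔ χ ≠ 1 := fun χ ↦
    ⟨fun h h1 ↦ UniformFloor.not_weilPositivityOnChar_one_principal (q := 22) (by decide) (h1 ▸ h), OneCompleteMod22.weilPositivityOnChar_mod22_one χ⟩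
  have key26 : ∀ χ : DirichletCharacter ℂ 26, WeilPositivityOnChar χ 1 ↔ χ ≠ 1 := fun χ ↦
    ⟨fun h h1 ↦ UniformFloor.not_weilPositivityOnChar_one_principal (q := 26) (by decide) (h1 ▸ h), OneCompleteMod26.weilPositivityOnChar_mod26_one χ⟩
  have key27 : ∀ χ : DirichletCharacter ℂ 27, WeilPositivityOnChar χ 1 ↔ χ ≠ 1 := fun χ ↦
    ⟨fun h h1 ↦ UniformFloor.not_weilPositivityOnChar_one_principal (q := 27) (by decide) (h1 ▸ h), OneCompleteMod27.weilPositivityOnChar_mod27_one χ⟩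
  have key28 : ∀ χ : DirichletCharacter ℂ 28, WeilPositivityOnChar χ 1 ↔ χ ≠ 1 := fun χ ↦
    ⟨fun h h1 ↦ UniformFloor.not_weilPositivityOnChar_one_principal (q := 28) (by decide) (h1 ▸ h), OneCompleteMod28.weilPositivityOnChar_mod28_one χ⟩
  have key31 : ∀ χ : DirichletCharacter ℂ 31, WeilPositivityOnChar χ 1 ↔ χ ≠ 1 := fun χ ↦
    ⟨fun h h1 ↦ UniformFloor.not_weilPositivityOnChar_one_principal (q := 31) (by decide) (h1 ▸ h), OneCompleteMod31.weilPositivityOnChar_mod31_one χ⟩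
  have key33 : ∀ χ : DirichletCharacter ℂ 33, WeilPositivityOnChar χ 1 ↔ χ ≠ 1 := fun χ ↦
    ⟨fun h h1 ↦ UniformFloor.not_weilPositivityOnChar_one_principal (q := 33) (by decide) (h1 ▸ h), OneCompleteMod33.weilPositivityOnChar_mod33_one χ⟩
  have key35 : ∀ χ : DirichletCharacter ℂ 35, WeilPositivityOnChar χ 1 ↔ χ ≠ 1 := fun χ ↦
    ⟨fun h h1 ↦ UniformFloor.not_weilPositivityOnChar_one_principal (q := 35) (by decide) (h1 ▸ h), OneCompleteMod35.weilPositivityOnChar_mod35_one χ⟩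
  have key37 : ∀ χ : DirichletCharacter ℂ 37, WeilPositivityOnChar χ 1 ↔ χ ≠ 1 := fun χ ↦
    ⟨fun h h1 ↦ UniformFloor.not_weilPositivityOnChar_one_principal (q := 37) (by decide) (h1 ▸ h), OneCompleteMod37.weilPositivityOnChar_mod37_one χ⟩
  have key39 : ∀ χ : DirichletCharacter ℂ 39, WeilPositivityOnChar χ 1 ↔ χ ≠ 1 := fun χ ↦
    ⟨fun h h1 ↦ UniformFloor.not_weilPositivityOnChar_one_principal (q := 39) (by decide) (h1 ▸ h), OneCompleteMod39.weilPositivityOnChar_mod39_one χ⟩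
  have key41 : ∀ χ : DirichletCharacter ℂ 41, WeilPositivityOnChar χ 1 ↔ χ ≠ 1 := fun χ ↦
    ⟨fun h h1 ↦ UniformFloor.not_weilPositivityOnChar_one_principal (q := 41) (by decide) (h1 ▸ h), OneCompleteMod41.weilPositivityOnChar_mod41_one χ⟩
  have key43 : ∀ χ : DirichletCharacter ℂ 43, WeilPositivityOnChar χ 1 ↔ χ ≠ 1 := fun χ ↦
    ⟨fun h h1 ↦ UniformFloor.not_weilPositivityOnChar_one_principal (q := 43) (by decide) (h1 ▸ h), OneCompleteMod43.weilPositivityOnChar_mod43_one χ⟩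
  have key47 : ∀ χ : DirichletCharacter ℂ 47, WeilPositivityOnChar χ 1 ↔ χ ≠ 1 := fun χ ↦
    ⟨fun h h1 ↦ UniformFloor.not_weilPositivityOnChar_one_principal (q := 47) (by decide) (h1 ▸ h), OneCompleteMod47.weilPositivityOnChar_mod47_one χ⟩
  have key49 : ∀ χ : DirichletCharacter ℂ 49, WeilPositivityOnChar χ 1 ↔ χ ≠ 1 := fun χ ↦
    ⟨fun h h1 ↦ UniformFloor.not_weilPositivityOnChar_one_principal (q := 49) (by decide) (h1 ▸ h), OneCompleteMod49.weilPositivityOnChar_mod49_one χ⟩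
  have key53 : ∀ χ : DirichletCharacter ℂ 53, WeilPositivityOnChar χ 1 ↔ χ ≠ 1 := fun χ ↦
    ⟨fun h h1 ↦ UniformFloor.not_weilPositivityOnChar_one_principal (q := 53) (by decide) (h1 ▸ h), OneCompleteMod53.weilPositivityOnChar_mod53_one χ⟩
  have key55 : ∀ χ : DirichletCharacter ℂ 55, WeilPositivityOnChar χ 1 ↔ χ ≠ 1 := fun χ ↦
    ⟨fun h h1 ↦ UniformFloor.not_weilPositivityOnChar_one_principal (q := 55) (by decide) (h1 ▸ h), OneCompleteMod55.weilPositivityOnChar_mod55_one χ⟩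
  have key59 : ∀ χ : DirichletCharacter ℂ 59, WeilPositivityOnChar χ 1 ↔ χ ≠ 1 := fun χ ↦
    ⟨fun h h1 ↦ UniformFloor.not_weilPositivityOnChar_one_principal (q := 59) (by decide) (h1 ▸ h), OneCompleteMod59.weilPositivityOnChar_mod59_one χ⟩
  have key61 : ∀ χ : DirichletCharacter ℂ 61, WeilPositivityOnChar χ 1 ↔ χ ≠ 1 := fun χ ↦
    ⟨fun h h1 ↦ UniformFloor.not_weilPositivityOnChar_one_principal (q := 61) (by decide) (h1 ▸ h), OneCompleteMod61.weilPositivityOnChar_mod61_one χ⟩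
  have key67 : ∀ χ : DirichletCharacter ℂ 67, WeilPositivityOnChar χ 1 ↔ χ ≠ 1 := fun χ ↦
    ⟨fun h h1 ↦ UniformFloor.not_weilPositivityOnChar_one_principal (q := 67) (by decide) (h1 ▸ h), OneCompleteMod67.weilPositivityOnChar_mod67_one χ⟩
  have key71 : ∀ χ : DirichletCharacter ℂ 71, WeilPositivityOnChar χ 1 ↔ χ ≠ 1 := fun χ ↦
    ⟨fun h h1 ↦ UniformFloor.not_weilPositivityOnChar_one_principal (q := 71) (by decide) (h1 ▸ h), OneCompleteMod71.weilPositivityOnChar_mod71_one χ⟩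
  have key73 : ∀ χ : DirichletCharacter ℂ 73, WeilPositivityOnChar χ 1 ↔ χ ≠ 1 := fun χ ↦
    ⟨fun h h1 ↦ UniformFloor.not_weilPositivityOnChar_one_principal (q := 73) (by decide) (h1 ▸ h), OneCompleteMod73.weilPositivityOnChar_mod73_one χ⟩
  have hq' : q = 12 ∨ q = 16 ∨ q = 20 ∨ q = 21 ∨ q = 22 ∨ q = 26 ∨ q = 27 ∨ q = 28 ∨ q = 31 ∨ q = 33 ∨ q = 35 ∨ q = 37 ∨ q = 39 ∨ q = 41 ∨ q = 43 ∨ q = 47 ∨ q = 49 ∨ q = 53 ∨ q = 55 ∨ q = 59 ∨ q = 61 ∨ q = 67 ∨ q = 71 ∨ q = 73 := by simpa using hq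
  rcases hq' with rfl | rfl | rfl | rfl | rfl | rfl | rfl | rfl | rfl | rfl | rfl | rfl | rfl | rfl | rfl | rfl | rfl | rfl | rfl | rfl | rfl | rfl | rfl | rfl
  · exact key12 χ
  · exact key16 χ
  · exact key20 χ
  · exact key21 χ
  · exact key22 χ
  · exact key26 χ
  · exact key27 χ
  · exact key28 χ
  · exact key31 χ
  · exact key33 χ
  · exact key35 χ
  · exact key37 χ
  · exact key39 χ
  · exact key41 χ
  · exact key43 χ
  · exact key47 χ
  · exact key49 χ
  · exact key53 χ
  · exact key55 χ
  · exact key59 χ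
  · exact key61 χ
  · exact key67 χ
  · exact key71 χ
  · exact key73 χ

/-- The failing set at each of these levels is the singleton `{1}`. [folklore] -/
theorem not_weilPositivityOnChar_one_iff_eq_one {q : ℕ}
    (hq : q ∈ ({12, 16, 20, 21, 22, 26, 27, 28, 31, 33, 35, 37, 39, 41, 43, 47, 49, 53, 55, 59, 61, 67, 71, 73} : Finset ℕ)) (χ : DirichletCharacter ℂ q) :
    ¬ WeilPositivityOnChar χ 1 ↔ χ = 1 := by
  rw [weilPositivityOnChar_one_iff_ne_one hq, not_ne_iff]

end Summit.Ventures.WeilGRH.OneCompleteLevels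

end
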